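import Literature.Geometry.Riemannian.PoincareWirtingerSublevel
import Literature.Geometry.Riemannian.ConnectedRegularDomain
import Literature.Geometry.Riemannian.RiemannianDistance
import Literature.Analysis.FunctionSpaces.SobolevCompleteness
import Mathlib.Analysis.InnerProductSpace.Completion
import Mathlib.Analysis.InnerProductSpace.Dual
import Mathlib.Analysis.Normed.Operator.Extend
import Mathlib.Geometry.Manifold.Algebra.SmoothFunctions
import HarnessLib

/-!
# Weak solutions of the Neumann problem `div(f ∇u) = F` on a regular sublevel domain

Topic `Geometry/Riemannian`. Theorem file (no definitions, no named facts; everything proved).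
Let `g` be a smooth Riemannian metric on a manifold `P` modelled on `ℝᵐ`, `D = {σ < 0}` a
connected regular sublevel domain with compact closure, `f > 0` continuous and `F` continuous
with `∫_D F dμ_g = 0`. The **variational (weak) solution of the Neumann problem**

  `div(f ∇u) = F` in `D`,  `f ∂_ν u = 0` on `∂D`

is produced in the form needed downstream: a sequence of SMOOTH functions `uₙ` on `P`,
Cauchy in energy (`∫_D |∇(uₙ − uₙ')|²_g → 0`), convergent in `L²(D)` to some `u`, whose
Dirichlet pairings converge to the weak equation
`∫_D f ⟨∇uₙ, ∇w⟩_g dμ_g → −∫_D F w dμ_g` for every smooth `w` on `P`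
(`exists_smooth_weakNeumann_approx`). This is the Riesz representation theorem in the completion
of the pre-Hilbert space `C^∞(P)` with the (semi-)inner product
`⟪u, w⟫ = ∫_D f ⟨∇u, ∇w⟩_g + (∫_D u)(∫_D w)`, on which `w ↦ −∫_D F w` is continuous by the
Poincaré–Wirtinger inequality on `D` (`exists_poincareWirtinger_sublevel`) and `∫_D F = 0`
(M. E. Taylor, *PDE I* (2011), §5.7, (7.11)–(7.14); D. Gilbarg, N. Trudinger (2001), §8.2;
L. C. Evans (2010), §6.2). The abstract step is `exists_cauchySeq_inner_tendsto`, the Riesz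
theorem for a continuous functional on a SEMI-normed real inner product space, realised by a
Cauchy sequence of the space itself (completion + density).

## References

* M. E. Taylor, *Partial Differential Equations I*, 2nd ed. (2011), §5.7. [TaylorPDEI2011]
* D. Gilbarg, N. S. Trudinger, *Elliptic PDE of Second Order* (2001), Thm. 5.8, §8.2.
  [GilbargTrudinger2001]
* L. C. Evans, *Partial Differential Equations*, 2nd ed. (2010), §6.2.1. [Evans2010]
-/

noncomputable section

open MeasureTheory Measure Set Filter Metric Module InnerProductSpace TopologicalSpace
open scoped ENNReal NNReal Manifold ContDiff Topology RealInnerProductSpace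

namespace Literature.Geometry.Riemannian

open Lorentzian
open Bundle PseudoRiemannianMetric Literature.Analysis.FunctionSpaces Literature.Geometry.Manifold

/-! ### Riesz representation through a Cauchy sequence, seminormed version -/

/-- **Riesz representation by a Cauchy sequence** in a real SEMI-normed inner product space `V`:
for every continuous linear functional `ℓ` there is a Cauchy sequence `vₙ` in `V` with
`⟪vₙ, w⟫ → ℓ w` for all `w ∈ V` (the Riesz vector of the extension of `ℓ` to the Hilbert-space
completion of `V`, approximated from the dense image of `V`). [folklore] -/
theorem exists_cauchySeq_inner_tendsto {V : Type*} [SeminormedAddCommGroup V]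
    [InnerProductSpace ℝ V] (ℓ : V →L[ℝ] ℝ) :
    ∃ v : ℕ → V, CauchySeq v ∧ ∀ w, Tendsto (fun n ↦ ⟪v n, w⟫) atTop (𝓝 (ℓ w)) := by
  set ι : V →L[ℝ] UniformSpace.Completion V := UniformSpace.Completion.toComplL with hι_def
  have hι : ∀ v, ι v = (v : UniformSpace.Completion V) := fun v => rfl
  have hd : DenseRange ι := by
    rw [hι_def, UniformSpace.Completion.coe_toComplL]
    exact UniformSpace.Completion.denseRange_coe
  have hui : IsUniformInducing ι := by
    rw [hι_def]
    show IsUniformInducing ((↑) : V → UniformSpace.Completion V)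
    exact UniformSpace.Completion.isUniformInducing_coe V
  set ℓ' : UniformSpace.Completion V →L[ℝ] ℝ := ℓ.extend ι with hℓ'_def
  have hℓ' : ∀ v, ℓ' (ι v) = ℓ v := fun v => ℓ.extend_eq hd hui v
  set u : UniformSpace.Completion V := (InnerProductSpace.toDual ℝ _).symm ℓ' with hu
  have hmem : u ∈ closure (range ι) := by rw [hd.closure_range]; exact mem_univ _
  obtain ⟨x, hx, hxu⟩ := mem_closure_iff_seq_limit.1 hmem
  choose v hv using hx
  have hconv : Tendsto (fun n ↦ ι (v n)) atTop (𝓝 u) := by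
    have : (fun n ↦ ι (v n)) = x := funext hv
    rw [this]; exact hxu
  have hcs : CauchySeq v := by
    have h1 : CauchySeq (fun n ↦ ι (v n)) := hconv.cauchySeq
    have h2 : Cauchy (map ι (map v atTop)) := by rw [Filter.map_map]; exact h1
    exact hui.cauchy_map_iff.1 h2
  refine ⟨v, hcs, fun w ↦ ?_⟩
  have h1 : ∀ n, ⟪v n, w⟫ = ⟪ι (v n), ι w⟫ := fun n ↦ by
    rw [hι, hι, UniformSpace.Completion.inner_coe]
  simp_rw [h1]
  have h2 : Tendsto (fun n ↦ ⟪ι (v n), ι w⟫) atTop (𝓝 ⟪u, ι w⟫) := hconv.inner tendsto_const_nhds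
  rw [hu, InnerProductSpace.toDual_symm_apply, hℓ'] at h2
  exact h2

/-! ### The setting -/

variable {m : ℕ} {P : Type*} [TopologicalSpace P] [ChartedSpace (EuclideanSpace ℝ (Fin m)) P]
  [IsManifold (𝓡 m) ∞ P] [T2Space P] [LocallyCompactSpace P] [MeasurableSpace P] [BorelSpace P]

variable (g : PseudoRiemannianMetric (𝓡 m) ∞ (EuclideanSpace ℝ (Fin m)) (TangentSpace (𝓡 m) : P → Type _))

omit [T2Space P] [LocallyCompactSpace P] [MeasurableSpace P] [BorelSpace P] in
/-- `g⁻¹(α + β, γ) = g⁻¹(α, γ) + g⁻¹(β, γ)`. [folklore] -/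
theorem innerDual_add_left' (x : P) (α β γ : Module.Dual ℝ (TangentSpace (𝓡 m) x)) :
    g.innerDual x (α + β) γ = g.innerDual x α γ + g.innerDual x β γ := by
  simp [PseudoRiemannianMetric.innerDual]

omit [T2Space P] [LocallyCompactSpace P] [MeasurableSpace P] [BorelSpace P] in
/-- `g⁻¹(c α, γ) = c g⁻¹(α, γ)`. [folklore] -/
theorem innerDual_smul_left'' (x : P) (c : ℝ) (α γ : Module.Dual ℝ (TangentSpace (𝓡 m) x)) :
    g.innerDual x (c • α) γ = c * g.innerDual x α γ := by
  simp [PseudoRiemannianMetric.innerDual]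

omit [T2Space P] [LocallyCompactSpace P] [MeasurableSpace P] [BorelSpace P] in
/-- For a Riemannian metric `g⁻¹(α, α) ≥ 0`. [folklore] -/
theorem innerDual_self_nonneg' (hg : g.IsRiemannian) (x : P)
    (α : Module.Dual ℝ (TangentSpace (𝓡 m) x)) : 0 ≤ g.innerDual x α α := by
  rw [PseudoRiemannianMetric.innerDual_eq_val_sharp_sharp]
  by_cases hv : g.sharp x α = 0
  · rw [hv]; simp
  · exact (hg x _ hv).le

omit [T2Space P] [LocallyCompactSpace P] [MeasurableSpace P] [BorelSpace P] in
/-- The Dirichlet pairing is additive in the first function. [folklore] -/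
theorem innerDual_mvfderiv_add_left' (x : P) {u v w : P → ℝ}
    (hu : MDifferentiableAt (𝓡 m) 𝓘(ℝ, ℝ) u x) (hv : MDifferentiableAt (𝓡 m) 𝓘(ℝ, ℝ) v x) :
    g.innerDual x (mvfderiv (𝓡 m) (u + v) x).toLinearMap (mvfderiv (𝓡 m) w x).toLinearMap =
      g.innerDual x (mvfderiv (𝓡 m) u x).toLinearMap (mvfderiv (𝓡 m) w x).toLinearMap +
      g.innerDual x (mvfderiv (𝓡 m) v x).toLinearMap (mvfderiv (𝓡 m) w x).toLinearMap := by
  rw [mvfderiv_add hu hv, ContinuousLinearMap.toLinearMap_add, innerDual_add_left']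

omit [T2Space P] [LocallyCompactSpace P] [MeasurableSpace P] [BorelSpace P] in
/-- The Dirichlet pairing is homogeneous in the first function. [folklore] -/
theorem innerDual_mvfderiv_smul_left' (x : P) {u w : P → ℝ}
    (hu : MDifferentiableAt (𝓡 m) 𝓘(ℝ, ℝ) u x) (c : ℝ) :
    g.innerDual x (mvfderiv (𝓡 m) (c • u) x).toLinearMap (mvfderiv (𝓡 m) w x).toLinearMap =
      c * g.innerDual x (mvfderiv (𝓡 m) u x).toLinearMap (mvfderiv (𝓡 m) w x).toLinearMap := by
  have h1 : mvfderiv (𝓡 m) (c • u) x = c • mvfderiv (𝓡 m) u x := by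
    have := mvfderiv_smul (mdifferentiableAt_const (c := c)) hu (I := 𝓡 m)
    rw [show (c • u) = (fun _ : P => c) • u from rfl] at *
    rw [this, mvfderiv_const]
    simp
  rw [h1, ContinuousLinearMap.toLinearMap_smul, innerDual_smul_left'']

omit [IsManifold (𝓡 m) ∞ P] [T2Space P] [LocallyCompactSpace P] [MeasurableSpace P] [BorelSpace P] in
/-- Subtracting a constant does not change the differential. [folklore] -/
theorem mvfderiv_sub_const' {u : P → ℝ} {x : P} (hu : MDifferentiableAt (𝓡 m) 𝓘(ℝ, ℝ) u x)
    (c : ℝ) : mvfderiv (𝓡 m) (fun y ↦ u y - c) x = mvfderiv (𝓡 m) u x := by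
  have h := mvfderiv_sub hu (mdifferentiableAt_const (c := c)) (I := 𝓡 m)
  rw [mvfderiv_const, sub_zero] at h
  exact h

/-! ### The weak Neumann problem -/

/-- **Weak solvability of the Neumann problem `div(f∇u) = F`, `f ∂_ν u = 0`, on a connected
regular sublevel domain, with smooth approximants.** Let `g` be a smooth Riemannian metric on
`P` (modelled on `ℝᵐ`), `σ ∈ C^∞(P)` with `{σ ≤ 0}` compact, `D = {σ < 0}` connected and
`dσ ≠ 0` on `{σ = 0}`; let `f > 0` and `F` be continuous with `∫_D F dμ_g = 0`. Then there are
smooth functions `uₙ` on `P` and `u ∈ L²(D, μ_g)` with `uₙ → u` in `L²(D)`,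
`∫_D |∇(uₙ − uₙ')|²_g dμ_g → 0`, and
`∫_D f g⁻¹(duₙ, dw) dμ_g → −∫_D F w dμ_g` for every smooth `w` on `P` — i.e. `u` is the
variational solution of the Neumann problem (Taylor, *PDE I*, §5.7, (7.11)–(7.14)).
[cite: TaylorPDEI2011, Ch. 5 §7, (7.11)–(7.14)] -/
theorem exists_smooth_weakNeumann_approx (hg : g.IsRiemannian) {σ : P → ℝ}
    (hσ : ContMDiff (𝓡 m) 𝓘(ℝ, ℝ) ∞ σ) (hcpt : IsCompact {x | σ x ≤ 0}) (hconn : IsConnected {x | σ x < 0})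
    (hreg : ∀ x, σ x = 0 → mvfderiv (𝓡 m) σ x ≠ 0)
    {f : P → ℝ} (hf : Continuous f) (hfpos : ∀ x, 0 < f x)
    {F : P → ℝ} (hF : Continuous F)
    (hmean : ∫ x in {x | σ x < 0}, F x ∂riemannianMeasure (g.toContMDiffRiemannianMetric hg) = 0) :
    ∃ (u : ℕ → P → ℝ) (v : P → ℝ), (∀ n, ContMDiff (𝓡 m) 𝓘(ℝ, ℝ) ∞ (u n)) ∧
      MemLp v 2 ((riemannianMeasure (g.toContMDiffRiemannianMetric hg)).restrict {x | σ x < 0}) ∧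
      Tendsto (fun n ↦ eLpNorm (u n - v) 2
        ((riemannianMeasure (g.toContMDiffRiemannianMetric hg)).restrict {x | σ x < 0}))
        atTop (𝓝 0) ∧
      (∀ ε > 0, ∃ N, ∀ n ≥ N, ∀ n' ≥ N,
        ∫ x in {x | σ x < 0}, g.gradSq (u n - u n') x
          ∂riemannianMeasure (g.toContMDiffRiemannianMetric hg) < ε) ∧
      ∀ w : P → ℝ, ContMDiff (𝓡 m) 𝓘(ℝ, ℝ) ∞ w →
        Tendsto (fun n ↦ ∫ x in {x | σ x < 0}, f x *
          g.innerDual x (mvfderiv (𝓡 m) (u n) x).toLinearMap (mvfderiv (𝓡 m) w x).toLinearMap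
            ∂riemannianMeasure (g.toContMDiffRiemannianMetric hg)) atTop
          (𝓝 (-∫ x in {x | σ x < 0}, F x * w x
            ∂riemannianMeasure (g.toContMDiffRiemannianMetric hg))) := by
  classical
  set h := g.toContMDiffRiemannianMetric hg with hh_def
  set μ : Measure P := riemannianMeasure h with hμ
  set D : Set P := {x | σ x < 0} with hD
  set Dbar : Set P := {x | σ x ≤ 0} with hDbar
  haveI : IsFiniteMeasureOnCompacts μ :=
    ⟨fun K hK ↦ riemannianVolume_lt_top_of_isCompact_holds h le_rfl hK⟩
  haveI : μ.IsOpenPosMeasure := isOpenPosMeasure_riemannianMeasure h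
  have hDo : IsOpen D := isOpen_lt hσ.continuous continuous_const
  have hDm : MeasurableSet D := hDo.measurableSet
  have hDDbar : D ⊆ Dbar := fun x (hx : σ x < 0) ↦ hx.le
  have hμD : μ D < ⊤ := (measure_mono hDDbar).trans_lt hcpt.measure_lt_top
  haveI : IsFiniteMeasure (μ.restrict D) := ⟨by rwa [Measure.restrict_apply_univ]⟩
  have hDne : D.Nonempty := hconn.nonempty
  have hμD0 : 0 < μ.real D := by
    rw [Measure.real, ENNReal.toReal_pos_iff]
    exact ⟨hDo.measure_pos μ hDne, hμD⟩
  -- a positive lower bound for `f` on `D`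
  obtain ⟨fmin, hfmin, hfge⟩ : ∃ fmin : ℝ, 0 < fmin ∧ ∀ x ∈ Dbar, fmin ≤ f x := by
    obtain ⟨x₀, hx₀, hmin⟩ := hcpt.exists_isMinOn (hDne.mono hDDbar) hf.continuousOn
    exact ⟨f x₀, hfpos x₀, fun x hx ↦ hmin hx⟩
  /- integrability of continuous functions on `D` -/
  have hintD : ∀ {φ : P → ℝ}, Continuous φ → IntegrableOn φ D μ := fun hφ ↦
    (hφ.continuousOn.integrableOn_compact hcpt).mono_set hDDbar
  have hbdd : ∀ {φ : P → ℝ}, Continuous φ → ∃ C, ∀ x ∈ D, |φ x| ≤ C := fun {φ} hφ ↦ by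
    obtain ⟨C, hC⟩ := hcpt.exists_bound_of_continuousOn hφ.continuousOn
    exact ⟨C, fun x hx ↦ by simpa [Real.norm_eq_abs] using hC x (hDDbar hx)⟩
  have hmemLp : ∀ {φ : P → ℝ}, Continuous φ → MemLp φ 2 (μ.restrict D) := fun {φ} hφ ↦ by
    obtain ⟨C, hC⟩ := hbdd hφ
    refine MemLp.of_bound hφ.aestronglyMeasurable C ?_
    rw [ae_restrict_iff' hDm]
    exact Eventually.of_forall fun x hx ↦ by rw [Real.norm_eq_abs]; exact hC x hx
  /- the Dirichlet pairing, the energy and the mean -/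
  obtain ⟨Pf, hPf⟩ : ∃ Pf : (P → ℝ) → (P → ℝ) → ℝ, ∀ u w, Pf u w =
      ∫ x in D, f x * g.innerDual x (mvfderiv (𝓡 m) u x).toLinearMap
        (mvfderiv (𝓡 m) w x).toLinearMap ∂μ := ⟨_, fun _ _ ↦ rfl⟩
  obtain ⟨En, hEn⟩ : ∃ En : (P → ℝ) → ℝ, ∀ u, En u = ∫ x in D, g.gradSq u x ∂μ :=
    ⟨_, fun _ ↦ rfl⟩
  obtain ⟨Mn, hMn⟩ : ∃ Mn : (P → ℝ) → ℝ, ∀ u, Mn u = ∫ x in D, u x ∂μ := ⟨_, fun _ ↦ rfl⟩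
  have hcontI : ∀ {u w : P → ℝ}, ContMDiff (𝓡 m) 𝓘(ℝ, ℝ) 1 u → ContMDiff (𝓡 m) 𝓘(ℝ, ℝ) 1 w → Continuous fun x ↦
      g.innerDual x (mvfderiv (𝓡 m) u x).toLinearMap (mvfderiv (𝓡 m) w x).toLinearMap :=
    fun hu hw ↦ continuous_innerDual_mvfderiv g hu hw
  have hPint : ∀ {u w : P → ℝ}, ContMDiff (𝓡 m) 𝓘(ℝ, ℝ) 1 u → ContMDiff (𝓡 m) 𝓘(ℝ, ℝ) 1 w → IntegrableOn (fun x ↦ f x *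
      g.innerDual x (mvfderiv (𝓡 m) u x).toLinearMap (mvfderiv (𝓡 m) w x).toLinearMap) D μ :=
    fun hu hw ↦ hintD (hf.mul (hcontI hu hw))
  have hPcomm : ∀ u w, Pf u w = Pf w u := fun u w ↦ by
    rw [hPf, hPf]
    exact integral_congr_ae (Eventually.of_forall fun x ↦ by
      simp only [PseudoRiemannianMetric.innerDual_comm g x (mvfderiv (𝓡 m) u x).toLinearMap])
  have hPadd : ∀ {u v w : P → ℝ}, ContMDiff (𝓡 m) 𝓘(ℝ, ℝ) 1 u → ContMDiff (𝓡 m) 𝓘(ℝ, ℝ) 1 v → ContMDiff (𝓡 m) 𝓘(ℝ, ℝ) 1 w →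
      Pf (u + v) w = Pf u w + Pf v w := by
    intro u v w hu hv hw
    rw [hPf, hPf, hPf, ← integral_add (hPint hu hw) (hPint hv hw)]
    refine integral_congr_ae (Eventually.of_forall fun x ↦ ?_)
    simp only
    rw [innerDual_mvfderiv_add_left' g x ((hu x).mdifferentiableAt one_ne_zero)
      ((hv x).mdifferentiableAt one_ne_zero), mul_add]
  have hPsmul : ∀ {u w : P → ℝ} (c : ℝ), ContMDiff (𝓡 m) 𝓘(ℝ, ℝ) 1 u → Pf (c • u) w = c * Pf u w := by
    intro u w c hu
    rw [hPf, hPf, ← integral_const_mul]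
    refine integral_congr_ae (Eventually.of_forall fun x ↦ ?_)
    simp only
    rw [innerDual_mvfderiv_smul_left' g x ((hu x).mdifferentiableAt one_ne_zero) c]; ring
  have hgradSq : ∀ (u : P → ℝ) x, g.gradSq u x =
      g.innerDual x (mvfderiv (𝓡 m) u x).toLinearMap (mvfderiv (𝓡 m) u x).toLinearMap :=
    fun u x ↦ rfl
  have hgradSq_nonneg : ∀ (u : P → ℝ) x, 0 ≤ g.gradSq u x := fun u x ↦ by
    rw [hgradSq]; exact innerDual_self_nonneg' g hg x _
  have hEn_nonneg : ∀ u, 0 ≤ En u := fun u ↦ by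
    rw [hEn]; exact integral_nonneg fun x ↦ hgradSq_nonneg u x
  have hPself_ge : ∀ {u : P → ℝ}, ContMDiff (𝓡 m) 𝓘(ℝ, ℝ) 1 u → fmin * En u ≤ Pf u u := by
    intro u hu
    rw [hPf, hEn, ← integral_const_mul]
    refine setIntegral_mono_on ((hintD (hcontI hu hu)).const_mul _) (hPint hu hu) hDm
      fun x hx ↦ ?_
    rw [← hgradSq]
    exact mul_le_mul_of_nonneg_right (hfge x (hDDbar hx)) (hgradSq_nonneg u x)
  have hPself_nonneg : ∀ {u : P → ℝ}, ContMDiff (𝓡 m) 𝓘(ℝ, ℝ) 1 u → 0 ≤ Pf u u := fun hu ↦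
    le_trans (mul_nonneg hfmin.le (hEn_nonneg _)) (hPself_ge hu)
  have hMn_add : ∀ {u v : P → ℝ}, Continuous u → Continuous v → Mn (u + v) = Mn u + Mn v := by
    intro u v hu hv
    rw [hMn, hMn, hMn, ← integral_add (hintD hu) (hintD hv)]; rfl
  have hMn_smul : ∀ (c : ℝ) (u : P → ℝ), Mn (c • u) = c * Mn u := by
    intro c u
    rw [hMn, hMn, ← integral_const_mul]; rfl
  /- the Poincaré–Wirtinger inequality in real form -/
  obtain ⟨Cp, hCp0, hPW⟩ : ∃ Cp : ℝ, 0 ≤ Cp ∧ ∀ ψ : P → ℝ, ContMDiff (𝓡 m) 𝓘(ℝ, ℝ) 1 ψ →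
      ∫ x in D, (ψ x - ⨍ y in D, ψ y ∂μ) ^ 2 ∂μ ≤ Cp * En ψ := by
    obtain ⟨C, hC, hpw⟩ := exists_poincareWirtinger_sublevel h hσ hcpt hconn hreg
    refine ⟨(C ^ 2).toReal, ENNReal.toReal_nonneg, fun ψ hψ ↦ ?_⟩
    have h1 := hpw ψ hψ
    set c : ℝ := ⨍ y in D, ψ y ∂μ with hc
    -- square both sides
    have h2 := pow_le_pow_left₀ (by simp) h1 2
    rw [mul_pow, ← ENNReal.rpow_natCast (_ ^ (1 / 2 : ℝ)) 2, ← ENNReal.rpow_mul] at h2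
    norm_num at h2
    -- identify the squared norms with real integrals
    have hψc : Continuous fun x ↦ ψ x - c := hψ.continuous.sub continuous_const
    have hsqi : IntegrableOn (fun x ↦ (ψ x - c) ^ 2) D μ := hintD (hψc.pow 2)
    have hL : eLpNorm (fun x ↦ ψ x - c) 2 (μ.restrict D) ^ 2 =
        ENNReal.ofReal (∫ x in D, (ψ x - c) ^ 2 ∂μ) := by
      rw [eLpNorm_eq_lintegral_rpow_enorm_toReal (by norm_num) (by norm_num), ENNReal.toReal_ofNat,
        ← ENNReal.rpow_natCast, ← ENNReal.rpow_mul]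
      norm_num
      rw [ofReal_integral_eq_lintegral_ofReal hsqi (Eventually.of_forall fun x ↦ sq_nonneg _)]
      refine lintegral_congr fun x ↦ ?_
      rw [← ENNReal.rpow_natCast, show ((2 : ℕ) : ℝ) = 2 by norm_num,
        Real.enorm_eq_ofReal_abs, ENNReal.ofReal_rpow_of_nonneg (abs_nonneg _) (by norm_num),
        Real.rpow_two, sq_abs]
    have hgi : IntegrableOn (g.gradSq ψ) D μ := hintD (hcontI hψ hψ)
    have hR : ∫⁻ x in D, ENNReal.ofReal ((PseudoRiemannianMetric.ofRiemannian h).innerDual x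
        (mvfderiv (𝓡 m) ψ x).toLinearMap (mvfderiv (𝓡 m) ψ x).toLinearMap) ∂μ =
        ENNReal.ofReal (En ψ) := by
      rw [hEn, ofReal_integral_eq_lintegral_ofReal hgi
        (Eventually.of_forall fun x ↦ hgradSq_nonneg ψ x)]
      rfl
    rw [hL, hR] at h2
    have h3 := ENNReal.toReal_mono (ENNReal.mul_ne_top (ENNReal.pow_ne_top hC) ENNReal.ofReal_ne_top) h2
    rwa [ENNReal.toReal_ofReal (integral_nonneg fun x ↦ sq_nonneg _), ENNReal.toReal_mul,
      ENNReal.toReal_ofReal (hEn_nonneg ψ)] at h3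
  /- the test space `W = C^∞(P)` -/
  obtain ⟨W, hW⟩ : ∃ W : Submodule ℝ (ContMDiffMap (𝓡 m) 𝓘(ℝ, ℝ) P ℝ ∞),
      ∀ φ : ContMDiffMap (𝓡 m) 𝓘(ℝ, ℝ) P ℝ ∞, φ ∈ W := ⟨⊤, fun _ ↦ trivial⟩
  obtain ⟨ev, hev⟩ : ∃ ev : W → P → ℝ, ∀ φ, ev φ = ⇑(φ : ContMDiffMap (𝓡 m) 𝓘(ℝ, ℝ) P ℝ ∞) :=
    ⟨_, fun _ ↦ rfl⟩
  have hevs : ∀ φ : W, ContMDiff (𝓡 m) 𝓘(ℝ, ℝ) ∞ (ev φ) := fun φ ↦ by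
    rw [hev]; exact (φ : ContMDiffMap (𝓡 m) 𝓘(ℝ, ℝ) P ℝ ∞).contMDiff
  have hev1 : ∀ φ : W, ContMDiff (𝓡 m) 𝓘(ℝ, ℝ) 1 (ev φ) := fun φ ↦ (hevs φ).of_le (by norm_cast)
  have hevc : ∀ φ : W, Continuous (ev φ) := fun φ ↦ (hevs φ).continuous
  have hev_add : ∀ φ ψ : W, ev (φ + ψ) = ev φ + ev ψ := fun φ ψ ↦ by rw [hev, hev, hev]; rfl
  have hev_smul : ∀ (c : ℝ) (φ : W), ev (c • φ) = c • ev φ := fun c φ ↦ by rw [hev, hev]; rfl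
  have hev_sub : ∀ φ ψ : W, ev (φ - ψ) = ev φ - ev ψ := fun φ ψ ↦ by rw [hev, hev, hev]; rfl
  have hev_mk : ∀ ζ : P → ℝ, ContMDiff (𝓡 m) 𝓘(ℝ, ℝ) ∞ ζ → ∃ φ : W, ev φ = ζ := fun ζ hζ ↦
    ⟨⟨⟨ζ, hζ⟩, hW _⟩, by rw [hev]; rfl⟩
  /- the semi-inner product `⟪φ, ψ⟫ = ∫_D f g⁻¹(dφ, dψ) + (∫_D φ)(∫_D ψ)` -/
  obtain ⟨core, hcore⟩ : ∃ core : PreInnerProductSpace.Core ℝ W,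
      ∀ φ ψ, core.inner φ ψ = Pf (ev φ) (ev ψ) + Mn (ev φ) * Mn (ev ψ) :=
    ⟨{ inner := fun φ ψ ↦ Pf (ev φ) (ev ψ) + Mn (ev φ) * Mn (ev ψ)
       conj_inner_symm := fun φ ψ ↦ by simp [hPcomm (ev φ) (ev ψ), mul_comm]
       re_inner_nonneg := fun φ ↦ by
         simpa using add_nonneg (hPself_nonneg (hev1 φ)) (mul_self_nonneg (Mn (ev φ)))
       add_left := fun φ ψ χ ↦ by
         rw [hev_add, hPadd (hev1 φ) (hev1 ψ) (hev1 χ), hMn_add (hevc φ) (hevc ψ)]; ring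
       smul_left := fun φ ψ r ↦ by
         simp only [conj_trivial]
         rw [hev_smul, hPsmul r (hev1 φ), hMn_smul]; ring }, fun _ _ ↦ rfl⟩
  letI : PreInnerProductSpace.Core ℝ W := core
  letI i1 : SeminormedAddCommGroup W := @InnerProductSpace.Core.toSeminormedAddCommGroup ℝ W _ _ _ core
  letI i2 : InnerProductSpace ℝ W := InnerProductSpace.ofCore core
  have hinner : ∀ φ ψ : W, ⟪φ, ψ⟫ = Pf (ev φ) (ev ψ) + Mn (ev φ) * Mn (ev ψ) := fun φ ψ ↦ hcore φ ψ
  have hnormsq : ∀ φ : W, ‖φ‖ ^ 2 = Pf (ev φ) (ev φ) + Mn (ev φ) * Mn (ev φ) := fun φ ↦ by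
    rw [← real_inner_self_eq_norm_sq, hinner]
  have hEn_le : ∀ φ : W, En (ev φ) ≤ fmin⁻¹ * ‖φ‖ ^ 2 := fun φ ↦ by
    rw [hnormsq, le_inv_mul_iff₀ hfmin]
    exact (hPself_ge (hev1 φ)).trans (le_add_of_nonneg_right (mul_self_nonneg _))
  /- the functional `ℓ ψ = −∫_D F ψ`, continuous by Poincaré–Wirtinger and `∫_D F = 0` -/
  set NF : ℝ := (∫ x in D, F x ^ 2 ∂μ) ^ (1 / (2 : ℝ)) with hNF
  have hNF0 : 0 ≤ NF := Real.rpow_nonneg (integral_nonneg fun x ↦ sq_nonneg _) _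
  have hℓ_bound : ∀ ψ : W, |∫ x in D, F x * ev ψ x ∂μ| ≤
      NF * Real.sqrt Cp * Real.sqrt fmin⁻¹ * ‖ψ‖ := by
    intro ψ
    set c : ℝ := ⨍ y in D, ev ψ y ∂μ with hc
    -- `∫_D F ψ = ∫_D F (ψ - c)` by `∫_D F = 0`
    have h1 : ∫ x in D, F x * ev ψ x ∂μ = ∫ x in D, F x * (ev ψ x - c) ∂μ := by
      have hi1 : IntegrableOn (fun x ↦ F x * (ev ψ x - c)) D μ :=
        hintD (hF.mul ((hevc ψ).sub continuous_const))
      have hi2 : IntegrableOn (fun x ↦ F x * c) D μ := hintD (hF.mul continuous_const)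
      have : (fun x ↦ F x * ev ψ x) = fun x ↦ F x * (ev ψ x - c) + F x * c := by
        funext x; ring
      rw [this, integral_add hi1 hi2, integral_mul_const]
      have hm : ∫ x in D, F x ∂μ = 0 := hmean
      rw [hm, zero_mul, add_zero]
    rw [h1]
    -- Cauchy–Schwarz
    have h2 : |∫ x in D, F x * (ev ψ x - c) ∂μ| ≤
        NF * (∫ x in D, (ev ψ x - c) ^ 2 ∂μ) ^ (1 / (2 : ℝ)) := by
      have hψc : Continuous fun x ↦ ev ψ x - c := (hevc ψ).sub continuous_const
      have h2e : ENNReal.ofReal 2 = 2 := by norm_num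
      have hm1 : MemLp (fun x ↦ |F x|) (ENNReal.ofReal 2) (μ.restrict D) := by
        rw [h2e]; exact (hmemLp hF).abs
      have hm2 : MemLp (fun x ↦ |ev ψ x - c|) (ENNReal.ofReal 2) (μ.restrict D) := by
        rw [h2e]; exact (hmemLp hψc).abs
      have key := integral_mul_le_Lp_mul_Lq_of_nonneg (μ := μ.restrict D) Real.HolderConjugate.two_two
        (Eventually.of_forall fun x ↦ abs_nonneg (F x))
        (Eventually.of_forall fun x ↦ abs_nonneg (ev ψ x - c)) hm1 hm2
      simp only [Real.rpow_two, sq_abs] at key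
      calc |∫ x in D, F x * (ev ψ x - c) ∂μ| ≤ ∫ x in D, |F x * (ev ψ x - c)| ∂μ :=
            abs_integral_le_integral_abs
        _ = ∫ x in D, |F x| * |ev ψ x - c| ∂μ := by simp_rw [abs_mul]
        _ ≤ NF * (∫ x in D, (ev ψ x - c) ^ 2 ∂μ) ^ (1 / (2 : ℝ)) := by rw [hNF]; exact key
    refine h2.trans ?_
    have h3 : (∫ x in D, (ev ψ x - c) ^ 2 ∂μ) ^ (1 / (2 : ℝ)) ≤
        Real.sqrt Cp * Real.sqrt fmin⁻¹ * ‖ψ‖ := by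
      rw [← Real.sqrt_eq_rpow (∫ x in D, (ev ψ x - c) ^ 2 ∂μ)]
      have h4 : ∫ x in D, (ev ψ x - c) ^ 2 ∂μ ≤ Cp * (fmin⁻¹ * ‖ψ‖ ^ 2) :=
        (hPW (ev ψ) (hev1 ψ)).trans (mul_le_mul_of_nonneg_left (hEn_le ψ) hCp0)
      calc Real.sqrt (∫ x in D, (ev ψ x - c) ^ 2 ∂μ) ≤ Real.sqrt (Cp * (fmin⁻¹ * ‖ψ‖ ^ 2)) :=
            Real.sqrt_le_sqrt h4
        _ = Real.sqrt Cp * Real.sqrt fmin⁻¹ * ‖ψ‖ := by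
            rw [Real.sqrt_mul hCp0, Real.sqrt_mul (inv_nonneg.2 hfmin.le),
              Real.sqrt_sq (norm_nonneg _), mul_assoc]
    calc NF * (∫ x in D, (ev ψ x - c) ^ 2 ∂μ) ^ (1 / (2 : ℝ))
        ≤ NF * (Real.sqrt Cp * Real.sqrt fmin⁻¹ * ‖ψ‖) := mul_le_mul_of_nonneg_left h3 hNF0
      _ = NF * Real.sqrt Cp * Real.sqrt fmin⁻¹ * ‖ψ‖ := by ring
  have hℓ_int : ∀ ψ : W, IntegrableOn (fun x ↦ F x * ev ψ x) D μ := fun ψ ↦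
    hintD (hF.mul (hevc ψ))
  have hℓex : ∃ ℓ₀ : W →L[ℝ] ℝ, ∀ ψ, ℓ₀ ψ = -∫ x in D, F x * ev ψ x ∂μ := by
    refine ⟨LinearMap.mkContinuous
      { toFun := fun ψ ↦ -∫ x in D, F x * ev ψ x ∂μ
        map_add' := ?_
        map_smul' := ?_ } (NF * Real.sqrt Cp * Real.sqrt fmin⁻¹) ?_, fun ψ ↦ rfl⟩
    · intro φ ψ
      rw [hev_add, ← neg_add, ← integral_add (hℓ_int φ) (hℓ_int ψ)]
      congr 1
      refine integral_congr_ae (Eventually.of_forall fun x ↦ ?_)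
      simp only [Pi.add_apply]; ring
    · intro c ψ
      simp only [RingHom.id_apply, smul_eq_mul]
      rw [hev_smul, mul_neg, ← integral_const_mul]
      congr 1
      refine integral_congr_ae (Eventually.of_forall fun x ↦ ?_)
      simp only [Pi.smul_apply, smul_eq_mul]; ring
    · intro ψ
      simp only [LinearMap.coe_mk, AddHom.coe_mk, Real.norm_eq_abs, abs_neg]
      exact hℓ_bound ψ
  obtain ⟨ℓ₀, hℓ₀⟩ := hℓex
  /- Riesz: a Cauchy sequence of smooth functions -/
  obtain ⟨vs, hvc, hvw⟩ := exists_cauchySeq_inner_tendsto ℓ₀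
  -- the means tend to zero (test with `w = 1`, using `∫_D F = 0`)
  obtain ⟨e1, he1⟩ := hev_mk (fun _ ↦ (1 : ℝ)) contMDiff_const
  have hP1 : ∀ u : P → ℝ, Pf u (fun _ ↦ (1 : ℝ)) = 0 := fun u ↦ by
    rw [hPf]
    refine integral_eq_zero_of_ae (Eventually.of_forall fun x ↦ ?_)
    simp [mvfderiv_const, PseudoRiemannianMetric.innerDual]
  have hM1 : Mn (fun _ ↦ (1 : ℝ)) = μ.real D := by
    rw [hMn, setIntegral_const, smul_eq_mul, mul_one]
  have hmean0 : Tendsto (fun n ↦ Mn (ev (vs n))) atTop (𝓝 0) := by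
    have h1 := hvw e1
    have h2 : ∀ n, ⟪vs n, e1⟫ = Mn (ev (vs n)) * μ.real D := fun n ↦ by
      rw [hinner, he1, hP1, hM1, zero_add]
    have h3 : ℓ₀ e1 = 0 := by
      rw [hℓ₀, he1]
      simp only [mul_one]
      have hm : ∫ x in D, F x ∂μ = 0 := hmean
      rw [hm, neg_zero]
    simp_rw [h2, h3] at h1
    have h4 := h1.mul_const (μ.real D)⁻¹
    rw [zero_mul] at h4
    refine h4.congr fun n ↦ ?_
    rw [mul_assoc, mul_inv_cancel₀ hμD0.ne', mul_one]
  /- the shifted sequence `uₙ = vₙ − ⨍_D vₙ` -/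
  set u : ℕ → P → ℝ := fun n x ↦ ev (vs n) x - ⨍ y in D, ev (vs n) y ∂μ with hu_def
  have hus : ∀ n, ContMDiff (𝓡 m) 𝓘(ℝ, ℝ) ∞ (u n) := fun n ↦ (hevs (vs n)).sub contMDiff_const
  have huc : ∀ n, Continuous (u n) := fun n ↦ (hus n).continuous
  have hmv : ∀ n x, mvfderiv (𝓡 m) (u n) x = mvfderiv (𝓡 m) (ev (vs n)) x := fun n x ↦
    mvfderiv_sub_const' (((hev1 (vs n)) x).mdifferentiableAt one_ne_zero) _
  have hmv2 : ∀ n n' x, mvfderiv (𝓡 m) (u n - u n') x =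
      mvfderiv (𝓡 m) (ev (vs n - vs n')) x := by
    intro n n' x
    have e : u n - u n' = fun y ↦ ev (vs n - vs n') y -
        ((⨍ y in D, ev (vs n) y ∂μ) - ⨍ y in D, ev (vs n') y ∂μ) := by
      funext y; simp only [hu_def, Pi.sub_apply, hev_sub]; ring
    rw [e]
    exact mvfderiv_sub_const' (((hev1 (vs n - vs n')) x).mdifferentiableAt one_ne_zero) _
  -- energy Cauchy
  have hEu : ∀ n n', En (u n - u n') = En (ev (vs n - vs n')) := fun n n' ↦ by
    rw [hEn, hEn]
    refine integral_congr_ae (Eventually.of_forall fun x ↦ ?_)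
    simp only [hgradSq, hmv2]
  have hdist : ∀ n n', ‖vs n - vs n'‖ = dist (vs n) (vs n') := fun n n' ↦ (dist_eq_norm _ _).symm
  have henergy : ∀ ε > 0, ∃ N, ∀ n ≥ N, ∀ n' ≥ N, En (u n - u n') < ε := by
    intro ε hε
    set ε' : ℝ := min 1 (fmin * ε) with hε'
    have hε'0 : 0 < ε' := lt_min one_pos (mul_pos hfmin hε)
    obtain ⟨N, hN⟩ := Metric.cauchySeq_iff.1 hvc ε' hε'0
    refine ⟨N, fun n hn n' hn' ↦ ?_⟩
    have h1 : ‖vs n - vs n'‖ < ε' := by rw [hdist]; exact hN n hn n' hn'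
    have h2 : En (ev (vs n - vs n')) ≤ fmin⁻¹ * ‖vs n - vs n'‖ ^ 2 := hEn_le _
    have h3 : ‖vs n - vs n'‖ ^ 2 < ε' := by
      have hle1 : ‖vs n - vs n'‖ ≤ 1 := h1.le.trans (min_le_left _ _)
      calc ‖vs n - vs n'‖ ^ 2 = ‖vs n - vs n'‖ * ‖vs n - vs n'‖ := sq _
        _ ≤ ‖vs n - vs n'‖ * 1 := mul_le_mul_of_nonneg_left hle1 (norm_nonneg _)
        _ < ε' := by rw [mul_one]; exact h1
    rw [hEu]
    calc En (ev (vs n - vs n')) ≤ fmin⁻¹ * ‖vs n - vs n'‖ ^ 2 := h2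
      _ < fmin⁻¹ * ε' := mul_lt_mul_of_pos_left h3 (inv_pos.2 hfmin)
      _ ≤ fmin⁻¹ * (fmin * ε) :=
          mul_le_mul_of_nonneg_left (min_le_right _ _) (inv_nonneg.2 hfmin.le)
      _ = ε := by rw [← mul_assoc, inv_mul_cancel₀ hfmin.ne', one_mul]
  /- the weak equation in the limit -/
  have hPf_u : ∀ n (w : P → ℝ), Pf (u n) w = Pf (ev (vs n)) w := fun n w ↦ by
    rw [hPf, hPf]
    refine integral_congr_ae (Eventually.of_forall fun x ↦ ?_)
    simp only [hmv]
  have hweak : ∀ w : P → ℝ, ContMDiff (𝓡 m) 𝓘(ℝ, ℝ) ∞ w →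
      Tendsto (fun n ↦ Pf (u n) w) atTop (𝓝 (-∫ x in D, F x * w x ∂μ)) := by
    intro w hw
    obtain ⟨φw, hφw⟩ := hev_mk w hw
    have h1 := hvw φw
    rw [hℓ₀, hφw] at h1
    have h2 : ∀ n, Pf (u n) w = ⟪vs n, φw⟫ - Mn (ev (vs n)) * Mn w := fun n ↦ by
      rw [hinner, hφw, hPf_u]; ring
    simp_rw [h2]
    have h3 := h1.sub (hmean0.mul_const (Mn w))
    rwa [zero_mul, sub_zero] at h3
  /- `L²(D)`-Cauchy, by Poincaré–Wirtinger (the `uₙ` have mean zero differences) -/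
  have hL2sq : ∀ n n', ∫ x in D, (u n x - u n' x) ^ 2 ∂μ ≤ Cp * En (u n - u n') := by
    intro n n'
    set ψ : P → ℝ := ev (vs n - vs n') with hψ
    have hψ1 : ContMDiff (𝓡 m) 𝓘(ℝ, ℝ) 1 ψ := hev1 _
    have h1 := hPW ψ hψ1
    have havg : ⨍ y in D, ψ y ∂μ = (⨍ y in D, ev (vs n) y ∂μ) - ⨍ y in D, ev (vs n') y ∂μ := by
      rw [hψ, hev_sub, setAverage_eq, setAverage_eq, setAverage_eq]
      simp only [Pi.sub_apply]
      rw [integral_sub (hintD (hevc _)) (hintD (hevc _)), smul_sub]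
    have hpt : ∀ x, ψ x - ⨍ y in D, ψ y ∂μ = u n x - u n' x := fun x ↦ by
      rw [havg, hψ, hev_sub]
      simp only [hu_def, Pi.sub_apply]; ring
    simp_rw [hpt] at h1
    rwa [hEu]
  have hL2 : ∀ ε : ℝ≥0∞, 0 < ε → ∃ N, ∀ n ≥ N, ∀ n' ≥ N,
      eLpNorm (u n - u n') 2 (μ.restrict D) < ε := by
    intro ε hε
    rcases eq_or_ne ε ⊤ with rfl | hεt
    · exact ⟨0, fun n _ n' _ ↦ (hmemLp ((huc n).sub (huc n'))).eLpNorm_lt_top⟩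
    have hεr : 0 < ε.toReal := ENNReal.toReal_pos hε.ne' hεt
    -- choose `N` with `Cp * En (u n - u n') < ε.toReal ^ 2`
    obtain ⟨N, hN⟩ := henergy (ε.toReal ^ 2 / (Cp + 1)) (by positivity)
    refine ⟨N, fun n hn n' hn' ↦ ?_⟩
    have h1 : ∫ x in D, (u n x - u n' x) ^ 2 ∂μ < ε.toReal ^ 2 := by
      refine (hL2sq n n').trans_lt ?_
      have h2 := hN n hn n' hn'
      calc Cp * En (u n - u n') ≤ (Cp + 1) * En (u n - u n') :=
            mul_le_mul_of_nonneg_right (by linarith) (hEn_nonneg _)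
        _ < (Cp + 1) * (ε.toReal ^ 2 / (Cp + 1)) := mul_lt_mul_of_pos_left h2 (by linarith)
        _ = ε.toReal ^ 2 := by field_simp
    -- translate to `eLpNorm`
    have hsqi : IntegrableOn (fun x ↦ (u n x - u n' x) ^ 2) D μ :=
      hintD (((huc n).sub (huc n')).pow 2)
    have hL : eLpNorm (u n - u n') 2 (μ.restrict D) ^ 2 =
        ENNReal.ofReal (∫ x in D, (u n x - u n' x) ^ 2 ∂μ) := by
      rw [eLpNorm_eq_lintegral_rpow_enorm_toReal (by norm_num) (by norm_num), ENNReal.toReal_ofNat,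
        ← ENNReal.rpow_natCast, ← ENNReal.rpow_mul]
      norm_num
      rw [ofReal_integral_eq_lintegral_ofReal hsqi (Eventually.of_forall fun x ↦ sq_nonneg _)]
      refine lintegral_congr fun x ↦ ?_
      rw [← ENNReal.rpow_natCast, show ((2 : ℕ) : ℝ) = 2 by norm_num,
        Real.enorm_eq_ofReal_abs, ENNReal.ofReal_rpow_of_nonneg (abs_nonneg _) (by norm_num),
        Real.rpow_two, sq_abs]
    by_contra hge'
    have hge := not_lt.1 hge'
    have h3 : ε ^ 2 ≤ eLpNorm (u n - u n') 2 (μ.restrict D) ^ 2 := pow_le_pow_left₀ (by simp) hge 2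
    rw [hL] at h3
    have h4 : ε ^ 2 = ENNReal.ofReal (ε.toReal ^ 2) := by
      rw [ENNReal.ofReal_pow hεr.le, ENNReal.ofReal_toReal hεt]
    rw [h4] at h3
    have h5 := (ENNReal.ofReal_le_ofReal_iff (integral_nonneg fun x ↦ sq_nonneg _)).1 h3
    linarith
  obtain ⟨v, hvm, hvt⟩ := exists_memLp_tendsto_of_cauchy (ν := μ.restrict D) one_le_two
    (fun n ↦ hmemLp (huc n)) hL2
  /- assemble -/
  refine ⟨u, v, hus, hvm, hvt, fun ε hε ↦ ?_, fun w hw ↦ ?_⟩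
  · obtain ⟨N, hN⟩ := henergy ε hε
    refine ⟨N, fun n hn n' hn' ↦ ?_⟩
    have := hN n hn n' hn'
    rwa [hEn] at this
  · have h1 := hweak w hw
    simp only [hPf] at h1
    exact h1

end Literature.Geometry.Riemannian

end
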